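import Summits.HodgeConjecture.HodgeConjecture.Theorems.F0P3cStCharTSCosetCover      -- ★ p849867 (LH2-p01): (CC3) `exists_cosetCover` — the cover `Ψ₀⁻¹(b′·S_n) = ⋃_{u∈F} u·S′`
import Summits.HodgeConjecture.HodgeConjecture.Theorems.F0P3cStCharTSValueAlgebra     -- ★ p849817 `card_mul_measure_eq_of_cover`
import Literature.NumberTheory.Rogawski1990.EndoscopicLeviTorusTransport               -- ★ `exists_leviTorus_continuousMulEquiv` (the torus iso `Ψ_T`)
import Literature.NumberTheory.Automorphic.LocalUnitaryGroupCongrMeasure                      -- ★ `secondCountableTopology_local`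
import HarnessLib

/-!
# F0 · P3c · line LH6 «StCharTS» — road (D) «HAAR-PSI★»: the torus isomorphism `Ψ_T : T_H ≃ₜ* T₃`, Haar transport along it, and the COUNT
# `#F · μ_H(S′) = (Ψ_T)_* μ_H (b′·S_n) = (Ψ_T)_* μ_H (S_n)` of the coset cover (R4 of (δ₄))

Cell `pub/hodgecm-mathlib`, crux H413 = `stmt-HodgeConjecture-24833` (lane `--supports`, helper); seat LH2-p02 (g3), deal «HAAR-PSI★» of road-(D) owner
LH6-p04 (g3) 2026-09-02T06:54:15Z (consumer LH6-p02 (g2), (δ₄)).  THEOREMS ONLY; sorry-free; no definition ∕ instance ∕ notation; axioms TRIO.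

* §1 (generic: `e : X ≃ₜ* T` an isomorphism of topological groups, `μ` left invariant on `X`) **`preimage_smul_set_eq`** (`e⁻¹(b′·S) = e⁻¹(b′)·e⁻¹(S)`), **`isMulLeftInvariant_map_equiv`**,
  **`card_mul_measure_eq_map_of_preimage_cover`** — if `e⁻¹(b′·S_n) = ⋃_{u ∈ F} u·S′` with the cosets pairwise disjoint then
  `#F · μ(S′) = (e_* μ)(S_n)` (★ `card_mul_measure_eq_of_cover` at `b := e⁻¹ b′`, `S := e⁻¹ S_n`), and **`map_apply_smul_set_eq`**: `(e_* μ)(b′·S_n) = (e_* μ)(S_n)`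
  (`e_* μ` is left invariant); **`exists_map_eq_smul_of_isHaarMeasure`** — `e_* μ_H = c • μ_T` with `c : ℝ≥0`, `c ≠ 0`, for Haar `μ_H`, `μ_T` (`haarScalarFactor`).
* §2 (CM) **`exists_torusIso`** — THE TORUS ISO in road-(D) tokens: `∃ Ψ_T : (↥(cmBorelTriple L 2 v).M × U(Φ₁)_v) ≃ₜ* ↥(cmBorelTriple L 3 v).M` with
  `((Ψ_T x : ↥T₃) : U₃) = endoEmbLocal L v (↑x.1, x.2)` (re-export of ★ `exists_leviTorus_continuousMulEquiv`; `(cmBorelTriple L N v).M = torusU … (cmLocalForm L N v)` by `rfl`);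
  **`card_mul_measure_eq_map_of_cosetCover`** — the COUNT in (δ₄)'s currency: for `Ψ_T` as above and the data of ★ (CC3) (`Ψ₀⁻¹(val '' (b′ • S_n)) = ⋃_{u∈F} u • S′`,
  disjoint), `↑F.card * μH ↑S′ = (μH.map Ψ_T) (b′ • ↑S_n)` and `(μH.map Ψ_T) (b′ • ↑S_n) = (μH.map Ψ_T) ↑S_n`, plus the `.real` forms.

HONEST LABEL: count-neutral measure plumbing for road (D); closes no organ.  HC_CM is proved only modulo the 7 printed citations (2 remaining: hLiu418 =
`stmt-HodgeConjecture-24832`, h413 = `stmt-HodgeConjecture-24833`) until rung 0 closes.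

## References
* [Rogawski1990] J. D. Rogawski, *Automorphic Representations of Unitary Groups in Three Variables*, Ann. of Math. Stud. 123 (1990), §4.9 Lemma 4.9.2 p. 56; §12.7
  L. 12.7.3 (proof) p. 195; §1.7 p. 6 (Haar measures).
* [DeitmarEchterhoff2014] A. Deitmar, S. Echterhoff, *Principles of Harmonic Analysis*, 2nd ed. (2014), Thm. 1.5.3 (uniqueness of Haar measure).
-/

set_option autoImplicit false
set_option linter.dupNamespace false

noncomputable section

open MeasureTheory Measure Set Filter Topology Function NumberField IsDedekindDomain
open Literature.NumberTheory.Automorphic Literature.NumberTheory.Automorphic.UnitaryGroup Literature.NumberTheory.Rogawski1990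
open Summit.HodgeConjecture.HodgeConjecture.Cruxes.H413.F0P3cStCharTSValueAlgebra
open scoped ENNReal NNReal MatrixGroups Pointwise

namespace Summit.HodgeConjecture.HodgeConjecture.Cruxes.H413.F0P3cStCharTSHaarPsi

/-! ## §1 Generic: preimages of translates, the count along a group isomorphism, Haar transport -/

section Generic

variable {X T : Type*} [Group X] [Group T] [TopologicalSpace X] [TopologicalSpace T]

/-- `e⁻¹(b′ • S) = e⁻¹(b′) • e⁻¹(S)` for a group isomorphism `e`. [folklore] -/
theorem preimage_smul_set_eq (e : X ≃ₜ* T) (b' : T) (S : Set T) : e ⁻¹' (b' • S) = e.symm b' • e ⁻¹' S := by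
  ext x
  rw [mem_preimage, mem_smul_set_iff_inv_smul_mem, mem_smul_set_iff_inv_smul_mem, mem_preimage, smul_eq_mul, smul_eq_mul,
    map_mul, map_inv, ContinuousMulEquiv.apply_symm_apply]

variable [IsTopologicalGroup T] [MeasurableSpace X] [BorelSpace X] [IsTopologicalGroup X] [MeasurableSpace T] [BorelSpace T]

/-- `e_* μ` is left invariant for `μ` left invariant and `e` a group isomorphism. [folklore] -/
theorem isMulLeftInvariant_map_equiv (e : X ≃ₜ* T) (μ : Measure X) [μ.IsMulLeftInvariant] : (μ.map e).IsMulLeftInvariant :=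
  MeasureTheory.isMulLeftInvariant_map (μ := μ) e.toMulEquiv.toMulHom (map_continuous e).measurable e.surjective

/-- **`(e_* μ)(b′ • S) = (e_* μ)(S)`** (left invariance of the transported measure). [cite: DeitmarEchterhoff2014, Thm. 1.5.3] -/
theorem map_apply_smul_set_eq (e : X ≃ₜ* T) (μ : Measure X) [μ.IsMulLeftInvariant] (b' : T) (S : Set T) :
    (μ.map e) (b' • S) = (μ.map e) S := by
  haveI := isMulLeftInvariant_map_equiv e μ
  exact measure_smul _ b' S

omit [IsTopologicalGroup T] in
/-- **THE COUNT ALONG `e`**: if `e⁻¹(b′ • S_n) = ⋃_{u ∈ F} u • S′` with the cosets `u • S′` pairwise disjoint (`S′`, `S_n` measurable, `μ` left invariant), then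
`#F · μ(S′) = (e_* μ)(S_n)` (★ `card_mul_measure_eq_of_cover` at `b := e⁻¹ b′`, `S := e⁻¹ S_n`). [cite: Rogawski1990, §4.9 Lemma 4.9.2 p. 56] -/
theorem card_mul_measure_eq_map_of_preimage_cover (e : X ≃ₜ* T) (μ : Measure X) [μ.IsMulLeftInvariant]
    {ι : Type*} (F : Finset ι) (u : ι → X) (S' : Set X) (hS' : MeasurableSet S') (Sn : Set T) (hSn : MeasurableSet Sn) (b' : T)
    (hcover : e ⁻¹' (b' • Sn) = ⋃ j ∈ F, u j • S') (hdisj : (F : Set ι).PairwiseDisjoint fun j => u j • S') :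
    (F.card : ℝ≥0∞) * μ S' = (μ.map e) Sn := by
  rw [Measure.map_apply (map_continuous e).measurable hSn]
  refine card_mul_measure_eq_of_cover μ F u (e ⁻¹' Sn) S' hS' (e.symm b') ?_ hdisj
  rw [← preimage_smul_set_eq, hcover]

/-- **Haar transport**: for Haar measures `μ_H` on `X` and `μ_T` on `T` (second countable, locally compact `T`), `e_* μ_H = c • μ_T` with `c : ℝ≥0`, `c ≠ 0`
(Haar uniqueness, Mathlib `isMulLeftInvariant_eq_smul` ∕ `haarScalarFactor_pos_of_isHaarMeasure`). [cite: DeitmarEchterhoff2014, Thm. 1.5.3] [cite: Rogawski1990, §1.7 p. 6] -/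
theorem exists_map_eq_smul_of_isHaarMeasure [LocallyCompactSpace T] [SecondCountableTopology T] (e : X ≃ₜ* T)
    (μH : Measure X) [μH.IsHaarMeasure] (μT : Measure T) [μT.IsHaarMeasure] :
    ∃ c : ℝ≥0, c ≠ 0 ∧ μH.map e = c • μT := by
  haveI : (μH.map e).IsHaarMeasure := ContinuousMulEquiv.isHaarMeasure_map μH e
  exact ⟨haarScalarFactor (μH.map e) μT, (haarScalarFactor_pos_of_isHaarMeasure (μH.map e) μT).ne',
    isMulLeftInvariant_eq_smul (μH.map e) μT⟩

end Generic

/-! ## §2 The CM tori: `Ψ_T : T_H = T₂ × U(Φ₁)_v ≃ₜ* T₃` and the count of the coset cover -/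

section CM

variable (L : Type) [Field L] [NumberField L] [IsCMField L] (v : HeightOneSpectrum (𝓞 ↥(maximalRealSubfield L)))

/-- **THE TORUS ISOMORPHISM `Ψ_T : T_H ≃ₜ* T₃`** in road-(D) tokens (`T_H = ↥(cmBorelTriple L 2 v).M × U(Φ₁)_v`, `T₃ = ↥(cmBorelTriple L 3 v).M`), with
`((Ψ_T x : T₃) : U₃) = ι_v(↑x.1, x.2)` — re-export of ★ `exists_leviTorus_continuousMulEquiv` (`(cmBorelTriple L N v).M = torusU … (cmLocalForm L N v)` by `rfl`).
[cite: Rogawski1990, §4.9 Lemma 4.9.2 p. 56; §12.7 L. 12.7.3 (proof) p. 195] -/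
theorem exists_torusIso :
    ∃ Ψ : (↥(cmBorelTriple L 2 v).M × ((cmDatum L 1 (Matrix.of fun i j : Fin 1 => if i.val + j.val + 1 = 1 then (1 : L) else 0)).Local v)) ≃ₜ* ↥(cmBorelTriple L 3 v).M, ∀ x : (↥(cmBorelTriple L 2 v).M × ((cmDatum L 1 (Matrix.of fun i j : Fin 1 => if i.val + j.val + 1 = 1 then (1 : L) else 0)).Local v)), (((Ψ x : ↥(cmBorelTriple L 3 v).M)) : ↥(unitaryGroupOfForm (conjLocal L (IsCMField.complexConj L) v) (cmLocalForm L 3 v))) = endoEmbLocal L v ((x.1 : ↥(unitaryGroupOfForm (conjLocal L (IsCMField.complexConj L) v) (cmLocalForm L 2 v))), x.2) :=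
  exists_leviTorus_continuousMulEquiv L v

set_option maxHeartbeats 400000 in
-- buildfix N9 (director s1355, 2026-09-02): the declaration sits on a 160k–200k heartbeat cliff (statement-level unification on the CM carriers); budgeted, no statement change
set_option maxHeartbeats 400000 in
/-- **THE COUNT OF THE COSET COVER, READ ON `T₃` THROUGH `Ψ_T`** ((R4) of (δ₄)): for `Ψ_T` as in `exists_torusIso`, a left-invariant `μ_H` on `T_H`, and the data of
★ (CC3) `exists_cosetCover` — `S_n ≤ T₃` compact, `b′ ∈ T₃`, `S′ ≤ T_H` open, a finite `F ⊆ T_H` with `Ψ₀⁻¹(val '' (b′ • S_n)) = ⋃_{u ∈ F} u • S′` and the cosets pairwise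
disjoint (`Ψ₀ x = ι_v(↑x.1, x.2)`) —: **`#F · μ_H(S′) = (Ψ_T)_* μ_H (b′ • S_n)`** and **`(Ψ_T)_* μ_H (b′ • S_n) = (Ψ_T)_* μ_H (S_n)`** (the second by left invariance of
`(Ψ_T)_* μ_H`).  With ★ `exists_map_eq_smul_of_isHaarMeasure` (`(Ψ_T)_* μ_H = c • μ_T`) the constant `c` is pinned on any one set of known measure.
[cite: Rogawski1990, §4.9 Lemma 4.9.2 p. 56; §12.7 L. 12.7.3 (proof) p. 195] [cite: DeitmarEchterhoff2014, Thm. 1.5.3] -/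
theorem card_mul_measure_eq_map_of_cosetCover
    [MeasurableSpace ↥(unitaryGroupOfForm (conjLocal L (IsCMField.complexConj L) v) (cmLocalForm L 2 v))] [BorelSpace ↥(unitaryGroupOfForm (conjLocal L (IsCMField.complexConj L) v) (cmLocalForm L 2 v))] [MeasurableSpace ((cmDatum L 1 (Matrix.of fun i j : Fin 1 => if i.val + j.val + 1 = 1 then (1 : L) else 0)).Local v)] [BorelSpace ((cmDatum L 1 (Matrix.of fun i j : Fin 1 => if i.val + j.val + 1 = 1 then (1 : L) else 0)).Local v)] [MeasurableSpace ↥(unitaryGroupOfForm (conjLocal L (IsCMField.complexConj L) v) (cmLocalForm L 3 v))] [BorelSpace ↥(unitaryGroupOfForm (conjLocal L (IsCMField.complexConj L) v) (cmLocalForm L 3 v))]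
    (Ψ : (↥(cmBorelTriple L 2 v).M × ((cmDatum L 1 (Matrix.of fun i j : Fin 1 => if i.val + j.val + 1 = 1 then (1 : L) else 0)).Local v)) ≃ₜ* ↥(cmBorelTriple L 3 v).M) (hΨ : ∀ x : (↥(cmBorelTriple L 2 v).M × ((cmDatum L 1 (Matrix.of fun i j : Fin 1 => if i.val + j.val + 1 = 1 then (1 : L) else 0)).Local v)), (((Ψ x : ↥(cmBorelTriple L 3 v).M)) : ↥(unitaryGroupOfForm (conjLocal L (IsCMField.complexConj L) v) (cmLocalForm L 3 v))) = endoEmbLocal L v ((x.1 : ↥(unitaryGroupOfForm (conjLocal L (IsCMField.complexConj L) v) (cmLocalForm L 2 v))), x.2))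
    (μH : Measure (↥(cmBorelTriple L 2 v).M × ((cmDatum L 1 (Matrix.of fun i j : Fin 1 => if i.val + j.val + 1 = 1 then (1 : L) else 0)).Local v))) [μH.IsMulLeftInvariant]
    (Sn : Subgroup ↥(cmBorelTriple L 3 v).M) (hSn : IsCompact (Sn : Set ↥(cmBorelTriple L 3 v).M)) (b' : ↥(cmBorelTriple L 3 v).M) (S' : Subgroup (↥(cmBorelTriple L 2 v).M × ((cmDatum L 1 (Matrix.of fun i j : Fin 1 => if i.val + j.val + 1 = 1 then (1 : L) else 0)).Local v))) (hS' : IsOpen (S' : Set (↥(cmBorelTriple L 2 v).M × ((cmDatum L 1 (Matrix.of fun i j : Fin 1 => if i.val + j.val + 1 = 1 then (1 : L) else 0)).Local v)))) (F : Finset (↥(cmBorelTriple L 2 v).M × ((cmDatum L 1 (Matrix.of fun i j : Fin 1 => if i.val + j.val + 1 = 1 then (1 : L) else 0)).Local v)))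
    (hcover : (fun x : (↥(cmBorelTriple L 2 v).M × ((cmDatum L 1 (Matrix.of fun i j : Fin 1 => if i.val + j.val + 1 = 1 then (1 : L) else 0)).Local v)) => endoEmbLocal L v ((x.1 : ↥(unitaryGroupOfForm (conjLocal L (IsCMField.complexConj L) v) (cmLocalForm L 2 v))), x.2)) ⁻¹' (Subtype.val '' (b' • (Sn : Set ↥(cmBorelTriple L 3 v).M))) = ⋃ u ∈ F, u • (S' : Set (↥(cmBorelTriple L 2 v).M × ((cmDatum L 1 (Matrix.of fun i j : Fin 1 => if i.val + j.val + 1 = 1 then (1 : L) else 0)).Local v))))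
    (hdisj : (↑F : Set (↥(cmBorelTriple L 2 v).M × ((cmDatum L 1 (Matrix.of fun i j : Fin 1 => if i.val + j.val + 1 = 1 then (1 : L) else 0)).Local v))).PairwiseDisjoint (fun u => u • (S' : Set (↥(cmBorelTriple L 2 v).M × ((cmDatum L 1 (Matrix.of fun i j : Fin 1 => if i.val + j.val + 1 = 1 then (1 : L) else 0)).Local v))))) :
    (F.card : ℝ≥0∞) * μH (S' : Set (↥(cmBorelTriple L 2 v).M × ((cmDatum L 1 (Matrix.of fun i j : Fin 1 => if i.val + j.val + 1 = 1 then (1 : L) else 0)).Local v))) = (μH.map Ψ) (b' • (Sn : Set ↥(cmBorelTriple L 3 v).M)) ∧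
      (μH.map Ψ) (b' • (Sn : Set ↥(cmBorelTriple L 3 v).M)) = (μH.map Ψ) (Sn : Set ↥(cmBorelTriple L 3 v).M) := by
  haveI : SecondCountableTopology ↥(unitaryGroupOfForm (conjLocal L (IsCMField.complexConj L) v) (cmLocalForm L 2 v)) := secondCountableTopology_local (IsCMField.complexConj L) 2 _ v
  haveI : SecondCountableTopology ((cmDatum L 1 (Matrix.of fun i j : Fin 1 => if i.val + j.val + 1 = 1 then (1 : L) else 0)).Local v) := secondCountableTopology_local (IsCMField.complexConj L) 1 _ v
  haveI : SecondCountableTopology ↥(unitaryGroupOfForm (conjLocal L (IsCMField.complexConj L) v) (cmLocalForm L 3 v)) := secondCountableTopology_local (IsCMField.complexConj L) 3 _ v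
  haveI : SecondCountableTopology ↥(cmBorelTriple L 2 v).M := TopologicalSpace.Subtype.secondCountableTopology _
  haveI : BorelSpace (↥(cmBorelTriple L 2 v).M × ((cmDatum L 1 (Matrix.of fun i j : Fin 1 => if i.val + j.val + 1 = 1 then (1 : L) else 0)).Local v)) := Prod.borelSpace
  have hpre : Ψ ⁻¹' (b' • (Sn : Set ↥(cmBorelTriple L 3 v).M)) = ⋃ u ∈ F, u • (S' : Set (↥(cmBorelTriple L 2 v).M × ((cmDatum L 1 (Matrix.of fun i j : Fin 1 => if i.val + j.val + 1 = 1 then (1 : L) else 0)).Local v))) := by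
    rw [← hcover]
    ext x
    rw [mem_preimage, mem_preimage, ← hΨ x, Subtype.val_injective.mem_set_image]
    exact Iff.rfl
  have h2 : (μH.map Ψ) (b' • (Sn : Set ↥(cmBorelTriple L 3 v).M)) = (μH.map Ψ) (Sn : Set ↥(cmBorelTriple L 3 v).M) := map_apply_smul_set_eq Ψ μH b' _
  refine ⟨?_, h2⟩
  rw [h2]
  exact card_mul_measure_eq_map_of_preimage_cover Ψ μH F (fun u => u) (S' : Set (↥(cmBorelTriple L 2 v).M × ((cmDatum L 1 (Matrix.of fun i j : Fin 1 => if i.val + j.val + 1 = 1 then (1 : L) else 0)).Local v))) hS'.measurableSet (Sn : Set ↥(cmBorelTriple L 3 v).M)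
    hSn.isClosed.measurableSet b' hpre hdisj

set_option maxHeartbeats 800000 in
-- statement-level unification of the (CC3) cover hypothesis on the CM carriers
/-- The `.real` form of the count: `#F · μ_H.real(S′) = ((Ψ_T)_* μ_H).real (b′ • S_n) = ((Ψ_T)_* μ_H).real (S_n)`. [cite: Rogawski1990, §12.7 L. 12.7.3 (proof) p. 195] -/
theorem card_mul_measureReal_eq_map_of_cosetCover
    [MeasurableSpace ↥(unitaryGroupOfForm (conjLocal L (IsCMField.complexConj L) v) (cmLocalForm L 2 v))] [BorelSpace ↥(unitaryGroupOfForm (conjLocal L (IsCMField.complexConj L) v) (cmLocalForm L 2 v))] [MeasurableSpace ((cmDatum L 1 (Matrix.of fun i j : Fin 1 => if i.val + j.val + 1 = 1 then (1 : L) else 0)).Local v)] [BorelSpace ((cmDatum L 1 (Matrix.of fun i j : Fin 1 => if i.val + j.val + 1 = 1 then (1 : L) else 0)).Local v)] [MeasurableSpace ↥(unitaryGroupOfForm (conjLocal L (IsCMField.complexConj L) v) (cmLocalForm L 3 v))] [BorelSpace ↥(unitaryGroupOfForm (conjLocal L (IsCMField.complexConj L) v) (cmLocalForm L 3 v))]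
    (Ψ : (↥(cmBorelTriple L 2 v).M × ((cmDatum L 1 (Matrix.of fun i j : Fin 1 => if i.val + j.val + 1 = 1 then (1 : L) else 0)).Local v)) ≃ₜ* ↥(cmBorelTriple L 3 v).M) (hΨ : ∀ x : (↥(cmBorelTriple L 2 v).M × ((cmDatum L 1 (Matrix.of fun i j : Fin 1 => if i.val + j.val + 1 = 1 then (1 : L) else 0)).Local v)), (((Ψ x : ↥(cmBorelTriple L 3 v).M)) : ↥(unitaryGroupOfForm (conjLocal L (IsCMField.complexConj L) v) (cmLocalForm L 3 v))) = endoEmbLocal L v ((x.1 : ↥(unitaryGroupOfForm (conjLocal L (IsCMField.complexConj L) v) (cmLocalForm L 2 v))), x.2))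
    (μH : Measure (↥(cmBorelTriple L 2 v).M × ((cmDatum L 1 (Matrix.of fun i j : Fin 1 => if i.val + j.val + 1 = 1 then (1 : L) else 0)).Local v))) [μH.IsMulLeftInvariant]
    (Sn : Subgroup ↥(cmBorelTriple L 3 v).M) (hSn : IsCompact (Sn : Set ↥(cmBorelTriple L 3 v).M)) (b' : ↥(cmBorelTriple L 3 v).M) (S' : Subgroup (↥(cmBorelTriple L 2 v).M × ((cmDatum L 1 (Matrix.of fun i j : Fin 1 => if i.val + j.val + 1 = 1 then (1 : L) else 0)).Local v))) (hS' : IsOpen (S' : Set (↥(cmBorelTriple L 2 v).M × ((cmDatum L 1 (Matrix.of fun i j : Fin 1 => if i.val + j.val + 1 = 1 then (1 : L) else 0)).Local v)))) (F : Finset (↥(cmBorelTriple L 2 v).M × ((cmDatum L 1 (Matrix.of fun i j : Fin 1 => if i.val + j.val + 1 = 1 then (1 : L) else 0)).Local v)))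
    (hcover : (fun x : (↥(cmBorelTriple L 2 v).M × ((cmDatum L 1 (Matrix.of fun i j : Fin 1 => if i.val + j.val + 1 = 1 then (1 : L) else 0)).Local v)) => endoEmbLocal L v ((x.1 : ↥(unitaryGroupOfForm (conjLocal L (IsCMField.complexConj L) v) (cmLocalForm L 2 v))), x.2)) ⁻¹' (Subtype.val '' (b' • (Sn : Set ↥(cmBorelTriple L 3 v).M))) = ⋃ u ∈ F, u • (S' : Set (↥(cmBorelTriple L 2 v).M × ((cmDatum L 1 (Matrix.of fun i j : Fin 1 => if i.val + j.val + 1 = 1 then (1 : L) else 0)).Local v))))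
    (hdisj : (↑F : Set (↥(cmBorelTriple L 2 v).M × ((cmDatum L 1 (Matrix.of fun i j : Fin 1 => if i.val + j.val + 1 = 1 then (1 : L) else 0)).Local v))).PairwiseDisjoint (fun u => u • (S' : Set (↥(cmBorelTriple L 2 v).M × ((cmDatum L 1 (Matrix.of fun i j : Fin 1 => if i.val + j.val + 1 = 1 then (1 : L) else 0)).Local v))))) :
    (F.card : ℝ) * μH.real (S' : Set (↥(cmBorelTriple L 2 v).M × ((cmDatum L 1 (Matrix.of fun i j : Fin 1 => if i.val + j.val + 1 = 1 then (1 : L) else 0)).Local v))) = (μH.map Ψ).real (b' • (Sn : Set ↥(cmBorelTriple L 3 v).M)) ∧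
      (μH.map Ψ).real (b' • (Sn : Set ↥(cmBorelTriple L 3 v).M)) = (μH.map Ψ).real (Sn : Set ↥(cmBorelTriple L 3 v).M) := by
  obtain ⟨h1, h2⟩ := card_mul_measure_eq_map_of_cosetCover L v Ψ hΨ μH Sn hSn b' S' hS' F hcover hdisj
  refine ⟨?_, by rw [measureReal_def, measureReal_def, h2]⟩
  rw [measureReal_def, measureReal_def, ← h1, ENNReal.toReal_mul, ENNReal.toReal_natCast]

end CM

end Summit.HodgeConjecture.HodgeConjecture.Cruxes.H413.F0P3cStCharTSHaarPsi
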